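import Literature.Geometry.DiscreteGeometry.LayerPropagationLocal
import HarnessLib

/-!
# L2B, file 1: the HCP propagation step in all six mirror-hexagon directions

HONEST FRAMING. Part of the venture `Summits/Ventures/Crystal3D` (cell `pub-crystal3d`, phase 2), a brick
of the radius-2 lemma `RadiusTwoBarlow` (`Bulk/PositionalOrder.lean`; design `HOME/lean/l2b/DESIGN.md`).
Nothing here is a crystallization claim; everything is elementary geometry of the close-packed tangent
arrangements in Hales's normalisation (unit balls, contact distance `2`, `kissingShell`), in the frame
`u₁ = triangularVec₁ 2`, `u₂ = triangularVec₂ 2`, `w = barlowOffset 2`, `h e₃ = layerNormal layerSpacing`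
of `Literature/…/LayerShells.lean` (written out in full — this file declares no notation, no definition).

## Contents (namespace `Summit.Ventures.Crystal3D.L2B`)

* the four hexagonal pairs `(u₁ − u₂, −u₂)`, `(u₂ − u₁, −u₁)`, `(u₁ − u₂, u₁)`, `(u₂ − u₁, u₂)` — the
  hexagon they span, `(η + η′)/3`, and the hole triple it spans — completing the eight pairs of
  `Literature/…/LayerPropagation.lean` (which serve the lattice directions `±u₁, ±u₂` only);
* **`kissingShell_add_eq_layerShell_of_hcp_hexagon`** — Hales's HCP step (*Dense Sphere Packings* §1.3,
  tree lemma `kissingShell_add_eq_layerShell_of_hcp_local`) along ANY of the six directions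
  `η ∈ hexagonSet`: if `p ∈ V` has shell `layerShell s s` and the shell of `p + η` is an FCC or HCP
  pattern, then `p + η ∈ V` with shell `layerShell s s`.
-/

noncomputable section

namespace Summit.Ventures.Crystal3D.L2B

open Literature.Geometry.DiscreteGeometry Literature.MathematicalPhysics.StatisticalMechanics
open RealInnerProductSpace

variable {V : Set (EuclideanSpace ℝ (Fin 3))}

/-! ## The four remaining hexagonal pairs (directions `±(u₁ − u₂)`) -/

/-- Pair `(u₁ − u₂, −u₂)`: hexagon. -/
theorem hexagonSet_eq_umv_nv :
    hexagonSet = ({triangularVec₁ (2 : ℝ) - triangularVec₂ (2 : ℝ),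
      -(triangularVec₁ (2 : ℝ) - triangularVec₂ (2 : ℝ)), -triangularVec₂ (2 : ℝ),
      -(-triangularVec₂ (2 : ℝ)), triangularVec₁ (2 : ℝ) - triangularVec₂ (2 : ℝ) - -triangularVec₂ (2 : ℝ),
      -triangularVec₂ (2 : ℝ) - (triangularVec₁ (2 : ℝ) - triangularVec₂ (2 : ℝ))} :
        Set (EuclideanSpace ℝ (Fin 3))) := by
  have e1 : (triangularVec₁ (2 : ℝ) : EuclideanSpace ℝ (Fin 3)) - triangularVec₂ (2 : ℝ) -
      -triangularVec₂ (2 : ℝ) = triangularVec₁ (2 : ℝ) := by abel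
  have e2 : -(triangularVec₂ (2 : ℝ) : EuclideanSpace ℝ (Fin 3)) -
      (triangularVec₁ (2 : ℝ) - triangularVec₂ (2 : ℝ)) = -triangularVec₁ (2 : ℝ) := by abel
  rw [e1, e2]
  ext x; simp only [hexagonSet, Set.mem_insert_iff, Set.mem_singleton_iff, neg_sub, neg_neg]; tauto

/-- Pair `(u₂ − u₁, −u₁)`: hexagon. -/
theorem hexagonSet_eq_vmu_nu :
    hexagonSet = ({triangularVec₂ (2 : ℝ) - triangularVec₁ (2 : ℝ),
      -(triangularVec₂ (2 : ℝ) - triangularVec₁ (2 : ℝ)), -triangularVec₁ (2 : ℝ),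
      -(-triangularVec₁ (2 : ℝ)), triangularVec₂ (2 : ℝ) - triangularVec₁ (2 : ℝ) - -triangularVec₁ (2 : ℝ),
      -triangularVec₁ (2 : ℝ) - (triangularVec₂ (2 : ℝ) - triangularVec₁ (2 : ℝ))} :
        Set (EuclideanSpace ℝ (Fin 3))) := by
  have e1 : (triangularVec₂ (2 : ℝ) : EuclideanSpace ℝ (Fin 3)) - triangularVec₁ (2 : ℝ) -
      -triangularVec₁ (2 : ℝ) = triangularVec₂ (2 : ℝ) := by abel
  have e2 : -(triangularVec₁ (2 : ℝ) : EuclideanSpace ℝ (Fin 3)) -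
      (triangularVec₂ (2 : ℝ) - triangularVec₁ (2 : ℝ)) = -triangularVec₂ (2 : ℝ) := by abel
  rw [e1, e2]
  ext x; simp only [hexagonSet, Set.mem_insert_iff, Set.mem_singleton_iff, neg_sub, neg_neg]; tauto


/-- Pair `(u₁ − u₂, u₁)`: hexagon. -/
theorem hexagonSet_eq_umv_u :
    hexagonSet = ({triangularVec₁ (2 : ℝ) - triangularVec₂ (2 : ℝ),
      -(triangularVec₁ (2 : ℝ) - triangularVec₂ (2 : ℝ)), triangularVec₁ (2 : ℝ), -triangularVec₁ (2 : ℝ),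
      triangularVec₁ (2 : ℝ) - triangularVec₂ (2 : ℝ) - triangularVec₁ (2 : ℝ),
      triangularVec₁ (2 : ℝ) - (triangularVec₁ (2 : ℝ) - triangularVec₂ (2 : ℝ))} :
        Set (EuclideanSpace ℝ (Fin 3))) := by
  have e1 : (triangularVec₁ (2 : ℝ) : EuclideanSpace ℝ (Fin 3)) - triangularVec₂ (2 : ℝ) -
      triangularVec₁ (2 : ℝ) = -triangularVec₂ (2 : ℝ) := by abel
  have e2 : (triangularVec₁ (2 : ℝ) : EuclideanSpace ℝ (Fin 3)) -
      (triangularVec₁ (2 : ℝ) - triangularVec₂ (2 : ℝ)) = triangularVec₂ (2 : ℝ) := by abel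
  rw [e1, e2]
  ext x; simp only [hexagonSet, Set.mem_insert_iff, Set.mem_singleton_iff, neg_sub]; tauto

/-- Pair `(u₂ − u₁, u₂)`: hexagon. -/
theorem hexagonSet_eq_vmu_v :
    hexagonSet = ({triangularVec₂ (2 : ℝ) - triangularVec₁ (2 : ℝ),
      -(triangularVec₂ (2 : ℝ) - triangularVec₁ (2 : ℝ)), triangularVec₂ (2 : ℝ), -triangularVec₂ (2 : ℝ),
      triangularVec₂ (2 : ℝ) - triangularVec₁ (2 : ℝ) - triangularVec₂ (2 : ℝ),
      triangularVec₂ (2 : ℝ) - (triangularVec₂ (2 : ℝ) - triangularVec₁ (2 : ℝ))} :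
        Set (EuclideanSpace ℝ (Fin 3))) := by
  have e1 : (triangularVec₂ (2 : ℝ) : EuclideanSpace ℝ (Fin 3)) - triangularVec₁ (2 : ℝ) -
      triangularVec₂ (2 : ℝ) = -triangularVec₁ (2 : ℝ) := by abel
  have e2 : (triangularVec₂ (2 : ℝ) : EuclideanSpace ℝ (Fin 3)) -
      (triangularVec₂ (2 : ℝ) - triangularVec₁ (2 : ℝ)) = triangularVec₁ (2 : ℝ) := by abel
  rw [e1, e2]
  ext x; simp only [hexagonSet, Set.mem_insert_iff, Set.mem_singleton_iff, neg_sub]; tauto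

/-- `((u₁ − u₂) + (−u₂))/3 = w − u₂`. -/
theorem third_smul_umv_add_nv :
    (1 / 3 : ℝ) • ((triangularVec₁ (2 : ℝ) : EuclideanSpace ℝ (Fin 3)) - triangularVec₂ (2 : ℝ) +
      -triangularVec₂ (2 : ℝ)) = barlowOffset (2 : ℝ) - triangularVec₂ (2 : ℝ) := by
  rw [frameW_eq]; module

/-- `((u₂ − u₁) + (−u₁))/3 = w − u₁`. -/
theorem third_smul_vmu_add_nu :
    (1 / 3 : ℝ) • ((triangularVec₂ (2 : ℝ) : EuclideanSpace ℝ (Fin 3)) - triangularVec₁ (2 : ℝ) +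
      -triangularVec₁ (2 : ℝ)) = barlowOffset (2 : ℝ) - triangularVec₁ (2 : ℝ) := by
  rw [frameW_eq]; module

/-- `((u₁ − u₂) + u₁)/3 = u₁ − w`. -/
theorem third_smul_umv_add_u :
    (1 / 3 : ℝ) • ((triangularVec₁ (2 : ℝ) : EuclideanSpace ℝ (Fin 3)) - triangularVec₂ (2 : ℝ) +
      triangularVec₁ (2 : ℝ)) = triangularVec₁ (2 : ℝ) - barlowOffset (2 : ℝ) := by
  rw [frameW_eq]; module

/-- `((u₂ − u₁) + u₂)/3 = u₂ − w`. -/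
theorem third_smul_vmu_add_v :
    (1 / 3 : ℝ) • ((triangularVec₂ (2 : ℝ) : EuclideanSpace ℝ (Fin 3)) - triangularVec₁ (2 : ℝ) +
      triangularVec₂ (2 : ℝ)) = triangularVec₂ (2 : ℝ) - barlowOffset (2 : ℝ) := by
  rw [frameW_eq]; module

/-- Hole triple of the pair `(u₁ − u₂, −u₂)` (type `1`). -/
theorem holeTriple_one_eq_umv_nv :
    holeTriple 1 = ({barlowOffset (2 : ℝ) - triangularVec₂ (2 : ℝ),
      barlowOffset (2 : ℝ) - triangularVec₂ (2 : ℝ) - (triangularVec₁ (2 : ℝ) - triangularVec₂ (2 : ℝ)),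
      barlowOffset (2 : ℝ) - triangularVec₂ (2 : ℝ) - -triangularVec₂ (2 : ℝ)} :
        Set (EuclideanSpace ℝ (Fin 3))) := by
  have e1 : (barlowOffset (2 : ℝ) : EuclideanSpace ℝ (Fin 3)) - triangularVec₂ (2 : ℝ) -
      (triangularVec₁ (2 : ℝ) - triangularVec₂ (2 : ℝ)) = barlowOffset (2 : ℝ) - triangularVec₁ (2 : ℝ) := by
    abel
  have e2 : (barlowOffset (2 : ℝ) : EuclideanSpace ℝ (Fin 3)) - triangularVec₂ (2 : ℝ) -
      -triangularVec₂ (2 : ℝ) = barlowOffset (2 : ℝ) := by abel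
  rw [e1, e2]
  ext x; simp only [holeTriple, one_smul, Set.mem_insert_iff, Set.mem_singleton_iff]; tauto

/-- Hole triple of the pair `(u₂ − u₁, −u₁)` (type `1`). -/
theorem holeTriple_one_eq_vmu_nu :
    holeTriple 1 = ({barlowOffset (2 : ℝ) - triangularVec₁ (2 : ℝ),
      barlowOffset (2 : ℝ) - triangularVec₁ (2 : ℝ) - (triangularVec₂ (2 : ℝ) - triangularVec₁ (2 : ℝ)),
      barlowOffset (2 : ℝ) - triangularVec₁ (2 : ℝ) - -triangularVec₁ (2 : ℝ)} :
        Set (EuclideanSpace ℝ (Fin 3))) := by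
  have e1 : (barlowOffset (2 : ℝ) : EuclideanSpace ℝ (Fin 3)) - triangularVec₁ (2 : ℝ) -
      (triangularVec₂ (2 : ℝ) - triangularVec₁ (2 : ℝ)) = barlowOffset (2 : ℝ) - triangularVec₂ (2 : ℝ) := by
    abel
  have e2 : (barlowOffset (2 : ℝ) : EuclideanSpace ℝ (Fin 3)) - triangularVec₁ (2 : ℝ) -
      -triangularVec₁ (2 : ℝ) = barlowOffset (2 : ℝ) := by abel
  rw [e1, e2]
  ext x; simp only [holeTriple, one_smul, Set.mem_insert_iff, Set.mem_singleton_iff]; tauto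

/-- Hole triple of the pair `(u₁ − u₂, u₁)` (type `−1`). -/
theorem holeTriple_neg_one_eq_umv_u :
    holeTriple (-1) = ({triangularVec₁ (2 : ℝ) - barlowOffset (2 : ℝ),
      triangularVec₁ (2 : ℝ) - barlowOffset (2 : ℝ) - (triangularVec₁ (2 : ℝ) - triangularVec₂ (2 : ℝ)),
      triangularVec₁ (2 : ℝ) - barlowOffset (2 : ℝ) - triangularVec₁ (2 : ℝ)} :
        Set (EuclideanSpace ℝ (Fin 3))) := by
  have e1 : (triangularVec₁ (2 : ℝ) : EuclideanSpace ℝ (Fin 3)) - barlowOffset (2 : ℝ) -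
      (triangularVec₁ (2 : ℝ) - triangularVec₂ (2 : ℝ)) = triangularVec₂ (2 : ℝ) - barlowOffset (2 : ℝ) := by
    abel
  have e2 : (triangularVec₁ (2 : ℝ) : EuclideanSpace ℝ (Fin 3)) - barlowOffset (2 : ℝ) -
      triangularVec₁ (2 : ℝ) = -barlowOffset (2 : ℝ) := by abel
  rw [e1, e2]
  ext x
  simp only [holeTriple, neg_smul, one_smul, neg_sub, Set.mem_insert_iff, Set.mem_singleton_iff]
  tauto

/-- Hole triple of the pair `(u₂ − u₁, u₂)` (type `−1`). -/
theorem holeTriple_neg_one_eq_vmu_v :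
    holeTriple (-1) = ({triangularVec₂ (2 : ℝ) - barlowOffset (2 : ℝ),
      triangularVec₂ (2 : ℝ) - barlowOffset (2 : ℝ) - (triangularVec₂ (2 : ℝ) - triangularVec₁ (2 : ℝ)),
      triangularVec₂ (2 : ℝ) - barlowOffset (2 : ℝ) - triangularVec₂ (2 : ℝ)} :
        Set (EuclideanSpace ℝ (Fin 3))) := by
  have e1 : (triangularVec₂ (2 : ℝ) : EuclideanSpace ℝ (Fin 3)) - barlowOffset (2 : ℝ) -
      (triangularVec₂ (2 : ℝ) - triangularVec₁ (2 : ℝ)) = triangularVec₁ (2 : ℝ) - barlowOffset (2 : ℝ) := by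
    abel
  have e2 : (triangularVec₂ (2 : ℝ) : EuclideanSpace ℝ (Fin 3)) - barlowOffset (2 : ℝ) -
      triangularVec₂ (2 : ℝ) = -barlowOffset (2 : ℝ) := by abel
  rw [e1, e2]
  ext x
  simp only [holeTriple, neg_smul, one_smul, neg_sub, Set.mem_insert_iff, Set.mem_singleton_iff]
  tauto

/-! ## The HCP step in all six hexagon directions -/

/-- **HCP propagation along any mirror-hexagon direction** (in the frame): if `p ∈ V` has shell
`layerShell s s`, `η ∈ hexagonSet`, and the shell of `p + η` is an FCC or HCP pattern, then
`p + η ∈ V` and its shell is `layerShell s s` as well. Twelve instances of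
`kissingShell_add_eq_layerShell_of_hcp_local` (six directions, two types). -/
theorem kissingShell_add_eq_layerShell_of_hcp_hexagon (hV : IsUnitBallPacking V) {s : ℝ}
    (hs : s = 1 ∨ s = -1) {p η : EuclideanSpace ℝ (Fin 3)} (hp : p ∈ V)
    (hshell : kissingShell V p = layerShell s s) (hη : η ∈ hexagonSet)
    (hshq : IsArrangedIn (kissingShell V (p + η)) fccKissingPattern ∨
      IsArrangedIn (kissingShell V (p + η)) hcpKissingPattern) :
    p + η ∈ V ∧ kissingShell V (p + η) = layerShell s s := by
  simp only [hexagonSet, Set.mem_insert_iff, Set.mem_singleton_iff] at hη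
  rcases hη with rfl | rfl | rfl | rfl | rfl | rfl
  · -- `η = u₁`
    rcases hs with rfl | rfl
    · exact kissingShell_add_eq_layerShell_of_hcp_local hV (η' := triangularVec₂ (2 : ℝ))
        (w' := barlowOffset (2 : ℝ)) (by norm_num) (by norm_num) (by norm_num) (by norm_num)
        (by norm_num) third_smul_u_add_v.symm hexagonSet_eq_uv (Or.inl rfl) holeTriple_one_eq_uv hp
        hshell hshq
    · exact kissingShell_add_eq_layerShell_of_hcp_local hV
        (η' := triangularVec₁ (2 : ℝ) - triangularVec₂ (2 : ℝ))
        (w' := triangularVec₁ (2 : ℝ) - barlowOffset (2 : ℝ)) (by norm_num) inner_self_frameU_sub_frameV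
        (by norm_num [inner_sub_right]) (by norm_num) (by norm_num [inner_sub_left])
        third_smul_u_add_umv.symm hexagonSet_eq_u_umv (Or.inr rfl) holeTriple_neg_one_eq_u_umv hp
        hshell hshq
  · -- `η = -u₁`
    rcases hs with rfl | rfl
    · exact kissingShell_add_eq_layerShell_of_hcp_local hV
        (η' := triangularVec₂ (2 : ℝ) - triangularVec₁ (2 : ℝ))
        (w' := barlowOffset (2 : ℝ) - triangularVec₁ (2 : ℝ)) (by norm_num) inner_self_frameV_sub_frameU
        (by norm_num [inner_sub_right]) (by norm_num) (by norm_num [inner_sub_left])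
        third_smul_nu_add_vmu.symm hexagonSet_eq_nu_vmu (Or.inl rfl) holeTriple_one_eq_nu_vmu hp
        hshell hshq
    · exact kissingShell_add_eq_layerShell_of_hcp_local hV (η' := -triangularVec₂ (2 : ℝ))
        (w' := -barlowOffset (2 : ℝ)) (by norm_num) (by norm_num) (by norm_num) (by norm_num)
        (by norm_num) third_smul_nu_add_nv.symm hexagonSet_eq_nu_nv (Or.inr rfl)
        holeTriple_neg_one_eq_nu_nv hp hshell hshq
  · -- `η = u₂`
    rcases hs with rfl | rfl
    · exact kissingShell_add_eq_layerShell_of_hcp_local hV (η' := triangularVec₁ (2 : ℝ))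
        (w' := barlowOffset (2 : ℝ)) (by norm_num) (by norm_num) (by norm_num) (by norm_num)
        (by norm_num) third_smul_v_add_u.symm hexagonSet_eq_vu (Or.inl rfl) holeTriple_one_eq_vu hp
        hshell hshq
    · exact kissingShell_add_eq_layerShell_of_hcp_local hV
        (η' := triangularVec₂ (2 : ℝ) - triangularVec₁ (2 : ℝ))
        (w' := triangularVec₂ (2 : ℝ) - barlowOffset (2 : ℝ)) (by norm_num) inner_self_frameV_sub_frameU
        (by norm_num [inner_sub_right]) (by norm_num) (by norm_num [inner_sub_left])
        third_smul_v_add_vmu.symm hexagonSet_eq_v_vmu (Or.inr rfl) holeTriple_neg_one_eq_v_vmu hp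
        hshell hshq
  · -- `η = -u₂`
    rcases hs with rfl | rfl
    · exact kissingShell_add_eq_layerShell_of_hcp_local hV
        (η' := triangularVec₁ (2 : ℝ) - triangularVec₂ (2 : ℝ))
        (w' := barlowOffset (2 : ℝ) - triangularVec₂ (2 : ℝ)) (by norm_num) inner_self_frameU_sub_frameV
        (by norm_num [inner_sub_right]) (by norm_num) (by norm_num [inner_sub_left])
        third_smul_nv_add_umv.symm hexagonSet_eq_nv_umv (Or.inl rfl) holeTriple_one_eq_nv_umv hp
        hshell hshq
    · exact kissingShell_add_eq_layerShell_of_hcp_local hV (η' := -triangularVec₁ (2 : ℝ))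
        (w' := -barlowOffset (2 : ℝ)) (by norm_num) (by norm_num) (by norm_num) (by norm_num)
        (by norm_num) third_smul_nv_add_nu.symm hexagonSet_eq_nv_nu (Or.inr rfl)
        holeTriple_neg_one_eq_nv_nu hp hshell hshq
  · -- `η = u₁ - u₂`
    rcases hs with rfl | rfl
    · exact kissingShell_add_eq_layerShell_of_hcp_local hV (η' := -triangularVec₂ (2 : ℝ))
        (w' := barlowOffset (2 : ℝ) - triangularVec₂ (2 : ℝ)) inner_self_frameU_sub_frameV (by norm_num)
        (by norm_num [inner_sub_left]) (by norm_num [inner_sub_left]) (by norm_num)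
        third_smul_umv_add_nv.symm hexagonSet_eq_umv_nv (Or.inl rfl) holeTriple_one_eq_umv_nv hp
        hshell hshq
    · exact kissingShell_add_eq_layerShell_of_hcp_local hV (η' := triangularVec₁ (2 : ℝ))
        (w' := triangularVec₁ (2 : ℝ) - barlowOffset (2 : ℝ)) inner_self_frameU_sub_frameV (by norm_num)
        (by norm_num [inner_sub_left]) (by norm_num [inner_sub_left]) (by norm_num)
        third_smul_umv_add_u.symm hexagonSet_eq_umv_u (Or.inr rfl) holeTriple_neg_one_eq_umv_u hp
        hshell hshq
  · -- `η = u₂ - u₁`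
    rcases hs with rfl | rfl
    · exact kissingShell_add_eq_layerShell_of_hcp_local hV (η' := -triangularVec₁ (2 : ℝ))
        (w' := barlowOffset (2 : ℝ) - triangularVec₁ (2 : ℝ)) inner_self_frameV_sub_frameU (by norm_num)
        (by norm_num [inner_sub_left]) (by norm_num [inner_sub_left]) (by norm_num)
        third_smul_vmu_add_nu.symm hexagonSet_eq_vmu_nu (Or.inl rfl) holeTriple_one_eq_vmu_nu hp
        hshell hshq
    · exact kissingShell_add_eq_layerShell_of_hcp_local hV (η' := triangularVec₂ (2 : ℝ))
        (w' := triangularVec₂ (2 : ℝ) - barlowOffset (2 : ℝ)) inner_self_frameV_sub_frameU (by norm_num)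
        (by norm_num [inner_sub_left]) (by norm_num [inner_sub_left]) (by norm_num)
        third_smul_vmu_add_v.symm hexagonSet_eq_vmu_v (Or.inr rfl) holeTriple_neg_one_eq_vmu_v hp
        hshell hshq

end Summit.Ventures.Crystal3D.L2B
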